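import Summits.HubbardSuperconductivity.HubbardSuperconductivity.Theorems.AnisotropyChordTransferFibre3BetaFreeTargets

/-!
# Route `AnisotropyChord` / H0 rotor rung: PORT PartN34 — L2 SPLIT INTO ITS ALGEBRAIC HALF (LEMMA κ₀) AND ITS SPECTRAL HALF (THEOREM G2)

Verbatim port (modulo this header, the port comment and lint options) of the theory seat's statement file
`hubbard-h0-rotor-theory-1/cycle21/lean/PartN34.lean` (sha16 `e9b34511d23f075d`; theory seat `hubbard-h0-rotor-theory-1` g21).
Statements only (targets typed by the theory seat; no proofs claimed here beyond what the theory file itself proves).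
Prover seat `hubbard-h0-rotor-p1` g22; helper for stmt-HubbardSuperconductivity-19089 (`--supports`).

Theory seat's own summary of the file:

# PART N34 — L2 (`L2Quant`) SPLIT INTO ITS ALGEBRAIC HALF (LEMMA κ₀) AND ITS SPECTRAL HALF (THEOREM G2)
theory seat hubbard-h0-rotor-theory-1, g21, REPORT 24 (answers p1 g22 REPORT 2 (iii)); memo 19 §250 (κ₀), §251–§255 (G2), memo 20 §279(d).

`Q̃(T) = (ΔW)⁻¹ − G^{hc}_SS(T)`, `G^{hc} := G − G 1_D P⁻¹ 1_D G` (the hard-core = Dirichlet-on-`D`, pole-removed free resolvent at `E = ε₁ + T`).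
* (L2-a) = `KappaZeroAlgebra` — PURE ALGEBRA + one completion of a square, PORTABLE NOW:
  if `H₀^{K₁} − W ≥ ε₁ + m₀` on hard-core functions orthogonal to the pole waves (`SecondGapK1 m₀`) and `m := m₀ − T ≥ 0`, then
  `Re⟨y, Q̃(T) y⟩ ≥ Σ_s |y_s|² (ηW_s + m)/(ΔW_s (W_s + m)) ≥ ((3η + m)/(3 + m)) Σ_s |y_s|²/(ΔW_s)`, `η = 1 − Δ`.
  PROOF. ψ₀ := G^{hc} y vanishes on D, is ⟂ the pole waves, and (H₀ − E)ψ₀ = (1−Π)(y − 1_D σ), so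
  ⟨y, G^{hc} y⟩ = 2Re⟨ψ₀, y⟩ − Re⟨ψ₀,(H₀−E)ψ₀⟩ (your DirichletResolvent identity ⟨Y,(H₀−E)Y⟩ = ⟨Y,R⟩);
  Re⟨ψ₀,(H₀ − E)ψ₀⟩ = Re⟨ψ₀,(H₀ − W)ψ₀⟩ + Σ_S W|ψ₀|² − (ε₁+T)‖ψ₀‖² ≥ Σ_S (W_s + m)|ψ₀(s)|²  (SecondGapK1, then drop m·(off-shell mass), m ≥ 0);
  hence ⟨y,G^{hc}y⟩ ≤ Σ_s [2Re(ψ₀(s)⁻ y_s) − (W_s+m)|ψ₀(s)|²] ≤ Σ_s |y_s|²/(W_s+m)  (pointwise 2Re(z̄y) − α|z|² ≤ |y|²/α);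
  so Re⟨y,Q̃y⟩ ≥ Σ_s |y_s|² [1/(ΔW_s) − 1/(W_s+m)] and (ηW+m)/(W+m) is decreasing in W ≤ 2 < 3. ∎
* (L2-b) = `SecondGapK1 (ε₁ cos²θ / 2)` — THE SPECTRAL INPUT = THEOREM G2 (memo 19): the second level of the isotropic (`Δ = 1`) three-magnon
  `K₁` fibre lies ≥ ε₁ + ½ε₁cos²θ (indeed ≥ min(2 gap₁, 3 gap₂) ≥ 1.5 ε₁ by LEMMA V + the hole gaps HOLE(.75,.5); note that for ψ vanishing on D,
  ⟨d, ψ⟩ = ⟨v, ψ⟩ where d = v·1_{Dᶜ} is the SU(2) descendant, so "⟂ pole waves" ⇒ "⟂ d" exactly and cos²θ is not even needed). STATUS ∀L: LEMMA V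
  elementary; hole gaps certified (Birman–Schwinger small matrices of one-body torus sums — FIN-class) for 4 ≤ L ≤ 512, and ∀L ≥ 20 with constant
  .38·cos²θ via LEMMA RS + CLR on the once-punctured torus (CLR10 Thm 1.1, arbitrary graphs). In Lean it is a NAMED HYPOTHESIS of the GM₃ theorem
  for now (like `FerroSectorGapCLR` was), discharged later.
* `L2QuantG` = `L2Quant` with the guards `T⁺ < 2ε₁`, `0 ≤ mHole` that (L2-a) needs (both are hypotheses of `KTAssemblyAbs` already, so the assembly
  proof swaps `L2Quant` for `L2QuantG` in one line); `mHole = ε₁cos²θ/2 − T⁺ = m₀ − T⁺` with `m₀ = ε₁ cos²θ/2`.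
Typing only; Mathlib + tree imports; no sorry, no axioms.
-/

-- Port of theory seat `hubbard-h0-rotor-theory-1` cycle21/lean/PartN34.lean (sha16 e9b34511d23f075d) verbatim modulo this header,
-- lint options and lint fixes; prover seat `hubbard-h0-rotor-p1` g22, `--supports stmt-HubbardSuperconductivity-19089`.

set_option linter.dupNamespace false
namespace Summit.HubbardSuperconductivity.HubbardSuperconductivity.Theorems.AnisotropyChord.Transfer.Fibre3

open Matrix

variable (L : ℕ) [NeZero L]

/-- `cos²θ := ‖d‖²/‖v‖² = (V−2)(V−3)/V² = 1 − 5/V + 6/V²`. -/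
noncomputable def cos2theta : ℝ := 1 - 5 / (L : ℝ) ^ 2 + 6 / ((L : ℝ) ^ 2) ^ 2

/-- SECOND-GAP HYPOTHESIS at the isotropic point (THEOREM G2, memo 19 §251–§255): on functions vanishing on the hard core and
orthogonal to the three pole waves, `Re⟨ψ,(H₀^{K₁} − W)ψ⟩ ≥ (ε₁ + m₀)‖ψ‖²`. -/
def SecondGapK1 (m0 : ℝ) : Prop :=
  ∀ ψ : Cfg L → ℂ, (∀ c : Cfg L, InD L c = true → ψ c = 0) → (∀ j : Fin 3, ip L (poleWave L j) ψ = 0) →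
    (eps1 L + m0) * (ip L ψ ψ).re ≤ (ip L ψ (Happly L (K1 L) (1 : ℝ) ψ)).re

/-- ★ LEMMA κ₀, ALGEBRAIC HALF (L2-a): `SecondGapK1 m₀`, `T ≤ m₀`, `T < 2ε₁`, `Δ ∈ (0,1]` ⇒
`((3η + m)/(3 + m))·Σ_s |y_s|²/(ΔW_s) ≤ Re⟨y, Q̃(T) y⟩`, `m = m₀ − T`, `η = 1 − Δ`. -/
def KappaZeroAlgebra : Prop :=
  ∀ T m0 Δ : ℝ, T < 2 * eps1 L → T ≤ m0 → 0 < Δ → Δ ≤ 1 → SecondGapK1 L m0 →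
    ∀ y : Ssub L → ℂ,
      (3 * (1 - Δ) + (m0 - T)) / (3 + (m0 - T)) * (∑ s : Ssub L, ‖y s‖ ^ 2 / (Δ * (Wcount L s.1 : ℝ)))
        ≤ (star y ⬝ᵥ (Qtilde L T Δ).mulVec y).re

/-- the sharper pointwise form of (L2-a): `Re⟨y,Q̃(T)y⟩ ≥ Σ_s |y_s|²·(ηW_s + m)/(ΔW_s(W_s + m))`. -/
def KappaZeroPointwise : Prop :=
  ∀ T m0 Δ : ℝ, T < 2 * eps1 L → T ≤ m0 → 0 < Δ → Δ ≤ 1 → SecondGapK1 L m0 →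
    ∀ y : Ssub L → ℂ,
      (∑ s : Ssub L, ‖y s‖ ^ 2 * (((1 - Δ) * (Wcount L s.1 : ℝ) + (m0 - T)) /
          (Δ * (Wcount L s.1 : ℝ) * ((Wcount L s.1 : ℝ) + (m0 - T)))))
        ≤ (star y ⬝ᵥ (Qtilde L T Δ).mulVec y).re

/-- `L2Quant` with the two guards the algebraic lemma needs (`T⁺ < 2ε₁`, `0 ≤ mHole = ε₁cos²θ/2 − T⁺`); both are hypotheses of
`KTAssemblyAbs` already. -/
def L2QuantG (Δ : ℝ) : Prop :=
  ∀ lam2 : ℝ, ∀ f : Tor L → ℝ, IsGroundTwoMagnon L Δ lam2 f → Tplus L Δ f < 2 * eps1 L → 0 ≤ mHole L Δ f →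
    ∀ y : Ssub L → ℂ,
      g0hat L Δ f * (∑ s : Ssub L, ‖y s‖ ^ 2 / (Δ * (Wcount L s.1 : ℝ)))
        ≤ (star y ⬝ᵥ (Qtilde L (Tplus L Δ f) Δ).mulVec y).re

/-- the intended theorem shape: (L2-a) + THEOREM G2 ⇒ guarded L2 (instantiate `T = T⁺`, `m₀ = ε₁cos²θ/2`, so `m₀ − T⁺ = mHole`). -/
def L2FromSecondGap (Δ : ℝ) : Prop :=
  0 < Δ → Δ ≤ 1 → KappaZeroAlgebra L → SecondGapK1 L (eps1 L * cos2theta L / 2) → L2QuantG L Δ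

/-- sanity: `mHole = ε₁·cos²θ/2 − T⁺` literally. -/
theorem mHole_eq (Δ : ℝ) (f : Tor L → ℝ) :
    mHole L Δ f = eps1 L * cos2theta L / 2 - Tplus L Δ f := by
  unfold mHole cos2theta; ring

end Summit.HubbardSuperconductivity.HubbardSuperconductivity.Theorems.AnisotropyChord.Transfer.Fibre3
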